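import Literature.MathematicalPhysics.QuantumFieldTheory.Balaban1983to89.Node00.RepTowerOfRecord
import Literature.MathematicalPhysics.QuantumFieldTheory.Balaban1983to89.T4DatumAssemblyTowerShadow

/-!
# The DATUM ASSEMBLER, TOWER FORM — AT THE REPRESENTED TOWER OF RECORD: def-T's densities `ρ_k := eval rep_k`, `𝐓ρ_k := eval (Tstep rep_k)`
# with their three faces ARE an `RGMachineCore.Tower (Node00.avOfRecord F N)` under the displayed provisos (the by-name ADAPTER), its datum,
# binder B1, the `rfl` read-backs, and the tower's INTEGRABILITY from the provisos

YM-PLAN Track A, node **N23** lineage (binder B1 `hD : D.IsPrintedAveraged`, T4ApexPrinted :135; seat `pub-ymgap-dag-n23-a`) — the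
successor trigger t4 of `HANDOFF-dag-n23-a.md` («the `RGMachineCore.Tower` obligations `rho_zero` ∕ `isRT_Trho` ∕ `integral_succ` = def-T's
three theorems, provisos displayed as hypotheses»), agreed with NODE 00's definer ₇b∕₉ (`pub-ymgap-node00-def-T`, bus «OFFER (a) YES»):
a ≈150-line module `Record9` imports BY NAME.  [III] = [Balaban1988Convergent], [IV] = [Balaban1989LargeFieldI].

WHAT THIS FILE IS.  §1 the DISPLAYED PROVISOS of a stage-₉ tower along histories `gOf p` (`TowerProvisos`: `gOf p 0 = p.g0`; def-T's
`TStepProvisos … p (gOf p) k` for `k < K`; def-R's `RepData.Provisos` of the pre-𝐑 tower of record at every level `k+1 ≤ K`) and along the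
GENERATED histories `gOf p := genSeq M.βfun p.g0` (`GenTowerProvisos`, `hg0` free by `genSeq_zero`) — Prop structures, hypotheses of a datum
(or clauses of NODE 00's `Stage9Params.Admissible`, its choice); §2 THE ADAPTER `towerOfRecord9 h : M.Tower (Node00.avOfRecord F N)` —
`ρ p k := rhoOfRecord9 F N ν τ M.E w ppSel p (gOf p) k`, `Trho p k := trhoOfRecord9 … p (gOf p) k`, the three obligations def-T's three
faces BY NAME (`rhoOfRecord9_zero` + `hg0`, `isRT_trhoOfRecord9`, `integral_rhoOfRecord9_succ`; no bridge lemma) — with `rfl` read-backs,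
the induced `R` mapping `𝐓ρ_k ↦ ρ_{k+1}`, and INTEGRABILITY of every `ρ_k`, `k ≤ K`, and every `𝐓ρ_k`, `k < K`, FROM THE PROVISOS
(`TStepProvisos.intPiece` summed; at the top level def-R's provisos through b01's `integrable_normTerm` — `integrable_rop_of_provisos`); §3 the
datum `datumOfTowerOfRecord9 h := datumOfTower F N M (towerOfRecord9 h)` with `dens`∕`Trho`∕`C`∕`βfun`∕`av` read-backs (`rfl`), the Stage-0
clause (`rfl`), binder B1 (node N23 at a stage-₉-shaped datum, hypothesis-free beyond the provisos that BUILD it), (2.18) for its densities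
with `rep_k` of record by construction, the T⁴ apex with B1 eliminated, and — along the generated histories — «THE SAME `g` feeds
`chiSeqOfRecord` and `(D.C p).flow`» (`⟨rfl, rfl⟩`; def-T's plug (5)); §4 the tower of record IS INTEGRABLE (`Tower.IsIntegrable` of the sibling
shadow module) and the two obligations of its SHADOW large-field operation `(towerOfRecord9 h).shadowR p k = inducedAt (rnTransport … ρ_k) ρ_{k+1}` — (0.4)
and integrability preservation — DISCHARGED from the provisos (the two proof fields NODE 00's `Record9` shadow residual needs, by name), the shadow
machine of the tower of record, and the Stage-5-family shadow datum with the same construction ∕ densities as `datumOfTowerOfRecord9 h`.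

## HONEST FRAMING — what this is NOT

* NOT a datum of record, NOT stage ₉, NOT `Record9`: `towerOfRecord9` ∕ `datumOfTowerOfRecord9` are FUNCTIONS of NODE 00's plugs — the core
  `M` (β of record, `E`, domains, actions, `χ`, the clauses read at the objects), def-R's numerics `ν`, `τ` and selector `ppSel` (A7), the
  step weights `w` (of record: `wOfRecord`, `Node00/StepWeightsOfRecord`), the histories `gOf`, and the PROVISOS `h`; NODE 00 chooses them.
* Nothing analytic of Bałaban's is proved or asserted: the two analytic faces are def-T's theorems FROM DISPLAYED HYPOTHESES; Theorems 1–2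
  [III], (2.19)–(2.44), (1.1)–(1.2) [IV] are NOT asserted; no node count moves.  One finite four-torus programme at fixed `ε` — NOT the
  continuum limit on ℝ⁴, NOT infinite volume, NOT OS, NOT a mass gap, NOT the Clay problem.
* No quotation locus is new (cell GAPS C-t4l-1; def-T's READING-NOTE-T9): [III] (2.18) p. 257, (3.1) p. 264, (3.24)–(3.25) p. 270, Thm 1
  p. 262; [IV] (0.2)–(0.4) p. 176; [Balaban1987RG1] (0.4) p. 253, (0.17)–(0.20) pp. 255–256; [Balaban1989LargeFieldII] Thm 1 + (0.1) pp. 355–356.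
-/

noncomputable section

open MeasureTheory

namespace Literature.MathematicalPhysics.QuantumFieldTheory.Balaban1983to89

namespace T4DatumAssembly

open Missing T4Continuum T4FiniteEpsInhabited FlowStepRuns DagBinding Node00

/-! ## 0. Integrability of the (0.3)-density of a representation datum under its provisos (b01's `integrable_normTerm`, summed) -/

/-- Under the provisos of [IV] p. 176 (measurable, non-negative, uniformly bounded pieces; nowhere-vanishing denominators) the (0.3)-density
`Σ_Z ρ(Z″,·)·∫⌈ρ(Z,·)/∫⌈ρ(Z″,·)` of a representation datum is INTEGRABLE — each normalised term by b01's `integrable_normTerm`.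
[cite: Balaban1989LargeFieldI, (0.3)–(0.4) p.176] -/
theorem integrable_rop_of_provisos {P : Params} {j : ℕ} {G : Type} [GaugeGroup G] [MeasurableSpace G] [HaarData G]
    [DecidableEq (PBond P j)] (d : B15RopTotal.RepData P j G) (h : d.Provisos) : Integrable d.rop (fieldMeasure P j G) := by
  letI := d.fin
  obtain ⟨hm, h0, ⟨C, hC⟩, hden⟩ := h
  exact integrable_finsetSum _ fun Z _ => B15.BasicStep.integrable_normTerm _ (hm _) (hm _) (h0 _) (hC _) (hC _) (hden Z)

/-! ## 1. The displayed provisos of a stage-₉ tower -/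

section Adapter

variable (F : T4Family) (N : ℕ) [NeZero N] (ν : Stage7Numerics) (τ : TowerNumerics)
  (M : RGMachineCore F (Matrix.specialUnitaryGroup (Fin N) ℂ))
  (w : StepWeightsOfRecord F N ν τ.M) (ppSel : PpSelOfRecord F ν τ.M)
  (gOf : B12.RunParams → ℕ → ℝ)

open Classical in
/-- **THE DISPLAYED PROVISOS of a stage-₉ tower** of the core `M` (whose `E` normalises `ρ₀`), def-R's numerics `ν`, `τ`, selector `ppSel`, step
weights `w`, along the histories `gOf p`: the history starts at the run's bare coupling; def-T's step provisos for every `k < K`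
(integrable level-`k` pieces, jointly measurable weights with `|w| ≤ 1`, measurable `χ_{k+1}`, the unity law `IsStepUnity`); def-R's
`RepData.Provisos` of the pre-𝐑 tower of record at every level `k+1 ≤ K` (the provisos of [IV] p. 176 under which (0.4) holds).  HYPOTHESES
of the datum — never fields of an object. [cite: Balaban1988Convergent, (3.1) p.264, (3.25) p.270; Balaban1989LargeFieldI, (0.3)–(0.4) p.176] -/
structure TowerProvisos : Prop where
  /-- the history of the run `p` starts at its bare coupling `g₀` -/
  hg0 : ∀ p : B12.RunParams, gOf p 0 = p.g0
  /-- def-T's step provisos at every step `k < K` -/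
  tstep : ∀ (p : B12.RunParams) (k : ℕ), k < p.K → TStepProvisos F N ν τ M.E w ppSel p (gOf p) k
  /-- def-R's provisos of the pre-𝐑 tower of record at every level `k+1 ≤ K` -/
  rstep : ∀ (p : B12.RunParams) (k : ℕ), k < p.K →
    (towerRepOfRecord F N ν τ (slotsTOfRecord F N ν τ M.E w ppSel) ppSel p (gOf p) (k + 1)).toRepData.Provisos

open Classical in
/-- The provisos ALONG THE GENERATED HISTORIES `gOf p := genSeq M.βfun p.g0` — the couplings the construction's flow carries
(`RGMachineCore.construction_g`); `hg0` is then `genSeq_zero`, free. [cite: Balaban1987RG1, (0.17)–(0.20) pp.255–256; Balaban1989LargeFieldI, (0.3)–(0.4) p.176] -/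
structure GenTowerProvisos : Prop where
  /-- def-T's step provisos at every step `k < K`, along the generated history -/
  tstep : ∀ (p : B12.RunParams) (k : ℕ), k < p.K → TStepProvisos F N ν τ M.E w ppSel p (genSeq M.βfun p.g0) k
  /-- def-R's provisos of the pre-𝐑 tower of record at every level `k+1 ≤ K`, along the generated history -/
  rstep : ∀ (p : B12.RunParams) (k : ℕ), k < p.K →
    (towerRepOfRecord F N ν τ (slotsTOfRecord F N ν τ M.E w ppSel) ppSel p (genSeq M.βfun p.g0) (k + 1)).toRepData.Provisos

variable {F N ν τ M w ppSel gOf}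

/-- Provisos along the generated histories are provisos along `gOf p := genSeq M.βfun p.g0`. [cite: Balaban1987RG1, (0.17) p.255 (bookkeeping)] -/
theorem GenTowerProvisos.towerProvisos (h : GenTowerProvisos F N ν τ M w ppSel) :
    TowerProvisos F N ν τ M w ppSel (fun p => genSeq M.βfun p.g0) :=
  ⟨fun p => genSeq_zero M.βfun p.g0, h.tstep, h.rstep⟩

/-! ## 2. THE ADAPTER: def-T's represented tower of record IS an explicit tower of the core along the averaging of record -/

open Classical in
/-- **THE TOWER OF RECORD AS AN `RGMachineCore.Tower`** (the by-name adapter): densities `ρ p k := rhoOfRecord9 … p (gOf p) k = eval rep_k`,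
transforms `Trho p k := trhoOfRecord9 … p (gOf p) k = eval (Tstep rep_k)`; the Wilson-start obligation by `rhoOfRecord9_zero` and `hg0` (the
core's `rhoZero p` IS `rhoZeroOfRecord F N p.K p.g0 (M.E p)`, `rfl`), the push-forward obligation by `isRT_trhoOfRecord9` under the step provisos,
(0.4) at the step by `integral_rhoOfRecord9_succ` under def-R's provisos (read, as in def-R's cone, with the classical `DecidableEq (PBond …)`
instance; in the `Record5` cone a consumer proves the `rstep` proviso by `convert`, TS-8). [cite: Balaban1988Convergent, (2.18) p.257, (3.25) p.270, Thm 1 p.262; Balaban1989LargeFieldI, (0.4) p.176] -/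
def towerOfRecord9 (h : TowerProvisos F N ν τ M w ppSel gOf) : M.Tower (avOfRecord F N) where
  ρ := fun p k => rhoOfRecord9 F N ν τ M.E w ppSel p (gOf p) k
  Trho := fun p k => trhoOfRecord9 F N ν τ M.E w ppSel p (gOf p) k
  rho_zero := fun p => by
    rw [rhoOfRecord9_zero, h.hg0 p]
    rfl
  isRT_Trho := fun p k hk => isRT_trhoOfRecord9 F N ν τ M.E w ppSel p (gOf p) k hk (h.tstep p k hk)
  integral_succ := fun p k hk => integral_rhoOfRecord9_succ F N ν τ M.E w ppSel p (gOf p) k (h.rstep p k hk)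

/-- Read-back: the tower's densities ARE def-T's `rhoOfRecord9` (`rfl`). [cite: Balaban1988Convergent, (2.18) p.257 (bookkeeping)] -/
theorem towerOfRecord9_ρ (h : TowerProvisos F N ν τ M w ppSel gOf) (p : B12.RunParams) (k : ℕ) :
    (towerOfRecord9 h).ρ p k = rhoOfRecord9 F N ν τ M.E w ppSel p (gOf p) k := rfl

/-- Read-back: the tower's `Tρ_k` ARE def-T's `trhoOfRecord9` (`rfl`). [cite: Balaban1988Convergent, (3.25) p.270 (bookkeeping)] -/
theorem towerOfRecord9_Trho (h : TowerProvisos F N ν τ M w ppSel gOf) (p : B12.RunParams) (k : ℕ) :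
    (towerOfRecord9 h).Trho p k = trhoOfRecord9 F N ν τ M.E w ppSel p (gOf p) k := rfl

/-- The induced large-field operation of the tower maps `𝐓ρ_k ↦ ρ_{k+1}` of record ((0.2) `ρ_{k+1} = 𝐑𝐓ρ_k`).
[cite: Balaban1988Convergent, (0.2) p.244; Balaban1989LargeFieldI, (0.3) p.176] -/
theorem inducedR_towerOfRecord9 (h : TowerProvisos F N ν τ M w ppSel gOf) (p : B12.RunParams) (k : ℕ) :
    (towerOfRecord9 h).inducedR p k (trhoOfRecord9 F N ν τ M.E w ppSel p (gOf p) k)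
      = rhoOfRecord9 F N ν τ M.E w ppSel p (gOf p) (k + 1) :=
  (towerOfRecord9 h).inducedR_Trho p k

/-- (2.18) holds for the tower's `ρ_k` with `rep_k` of record, by construction. [cite: Balaban1988Convergent, (2.18) p.257 (bookkeeping)] -/
theorem holds_towerOfRecord9_ρ (h : TowerProvisos F N ν τ M w ppSel gOf) (p : B12.RunParams) (k : ℕ) :
    (repOfRecord9 F N ν τ M.E w ppSel p (gOf p) k).Holds ((towerOfRecord9 h).ρ p k) :=
  holds_repOfRecord9 F N ν τ M.E w ppSel p (gOf p) k

/-- (2.18) holds for the tower's `𝐓ρ_k` with `Tstep rep_k` of record, by construction. [cite: Balaban1988Convergent, (3.25) p.270 (bookkeeping)] -/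
theorem holds_towerOfRecord9_Trho (h : TowerProvisos F N ν τ M w ppSel gOf) (p : B12.RunParams) (k : ℕ) :
    (repTOfRecord9 F N ν τ M.E w ppSel p (gOf p) k).Holds ((towerOfRecord9 h).Trho p k) :=
  holds_repTOfRecord9 F N ν τ M.E w ppSel p (gOf p) k

/-! ### Integrability of the tower FROM THE PROVISOS (the display READ #43 N-n23-T1 asked of stage ₉) -/

/-- `ρ_k` is integrable for `k < K`: the displayed step proviso `TStepProvisos.intPiece` summed over the finitely many sequences (`densityOfRepr`
is the finite sum). [cite: Balaban1988Convergent, (2.18) p.257 (bookkeeping)] -/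
theorem integrable_towerOfRecord9_ρ_of_lt (h : TowerProvisos F N ν τ M w ppSel gOf) (p : B12.RunParams) (k : ℕ) (hk : k < p.K) :
    Integrable ((towerOfRecord9 h).ρ p k) (fieldMeasure (F.P p.K) k (Matrix.specialUnitaryGroup (Fin N) ℂ)) :=
  integrable_finsetSum Finset.univ (fun s _ => (h.tstep p k hk).intPiece s)

/-- `𝐓ρ_k` is integrable for `k < K`: def-T's `integrable_piece_trhoOfRecord9` summed. [cite: Balaban1988Convergent, (3.25) p.270 (bookkeeping)] -/
theorem integrable_towerOfRecord9_Trho (h : TowerProvisos F N ν τ M w ppSel gOf) (p : B12.RunParams) (k : ℕ) (hk : k < p.K) :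
    Integrable ((towerOfRecord9 h).Trho p k) (fieldMeasure (F.P p.K) (k + 1) (Matrix.specialUnitaryGroup (Fin N) ℂ)) :=
  integrable_finsetSum Finset.univ
    (fun s' _ => integrable_piece_trhoOfRecord9 F N ν τ M.E w ppSel p (gOf p) k hk (h.tstep p k hk) s')

/-- `ρ₀` is integrable on every run (also `K = 0`): `e^{−E(p)}` times the tree's Wilson–Boltzmann weight at `β = g₀⁻²`
(`Missing.integrable_boltzmann`). [cite: Balaban1988Convergent, Thm 1 p.262 (bookkeeping)] -/
theorem integrable_towerOfRecord9_ρ_zero (h : TowerProvisos F N ν τ M w ppSel gOf) (p : B12.RunParams) :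
    Integrable ((towerOfRecord9 h).ρ p 0) (fieldMeasure (F.P p.K) 0 (Matrix.specialUnitaryGroup (Fin N) ℂ)) := by
  rw [(towerOfRecord9 h).rho_zero p]
  exact (Missing.integrable_boltzmann RegularGaugeGroup.measurable_reTr (F.P p.K) (sq_nonneg _)).const_mul _

open Classical in
/-- `ρ_{k+1}` is integrable for `k < K` (so up to the TOP level `K`): it IS the (0.3)-density of the pre-𝐑 tower of record at level `k+1` (def-R's
`rop_towerRepOfRecord_eq_densityOfSlice`, def-T's `rhoOfRecord9_succ`), integrable under def-R's displayed provisos (`integrable_rop_of_provisos`).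
[cite: Balaban1989LargeFieldI, (0.3)–(0.4) p.176] -/
theorem integrable_towerOfRecord9_ρ_succ (h : TowerProvisos F N ν τ M w ppSel gOf) (p : B12.RunParams) (k : ℕ) (hk : k < p.K) :
    Integrable ((towerOfRecord9 h).ρ p (k + 1)) (fieldMeasure (F.P p.K) (k + 1) (Matrix.specialUnitaryGroup (Fin N) ℂ)) := by
  have e := rop_towerRepOfRecord_slotsT F N ν τ M.E w ppSel p (gOf p) k
  rw [towerOfRecord9_ρ, ← e]
  exact integrable_rop_of_provisos _ (h.rstep p k hk)

/-- **THE TOWER OF RECORD IS INTEGRABLE**: every `ρ_k`, `k ≤ K`, of every run is integrable for product Haar measure — from the displayed provisos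
alone (the shape `RGMachineCore.Tower.IsIntegrable` of the sibling shadow module, unfolded). [cite: Balaban1988Convergent, (0.2) p.244 (kernel property of the tower, bookkeeping)] -/
theorem integrable_towerOfRecord9_ρ (h : TowerProvisos F N ν τ M w ppSel gOf) (p : B12.RunParams) :
    ∀ k, k ≤ p.K → Integrable ((towerOfRecord9 h).ρ p k) (fieldMeasure (F.P p.K) k (Matrix.specialUnitaryGroup (Fin N) ℂ))
  | 0, _ => integrable_towerOfRecord9_ρ_zero h p
  | k + 1, hk => integrable_towerOfRecord9_ρ_succ h p k (Nat.lt_of_succ_le hk)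

/-! ## 3. The datum of the tower of record; B1 = node N23 at it; read-backs -/

/-- **THE STAGE-₉-SHAPED DATUM of the core `M` and the tower of record** along NODE 00's averaging of record (`datumOfTower` at the adapter): its
construction is the core's over `eval rep_k`, its realisation carries the EXPLICIT `𝐓ρ_k` and the induced `𝐑` (no `rnDeriv`; chair R437 (1)).  A
FUNCTION of NODE 00's plugs; `Record9` instantiates it. [cite: Balaban1989LargeFieldII, Thm 1 + (0.1) pp.355–356; Balaban1988Convergent, (0.2) p.244] -/
def datumOfTowerOfRecord9 (h : TowerProvisos F N ν τ M w ppSel gOf) : FiniteEpsData F (Matrix.specialUnitaryGroup (Fin N) ℂ) :=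
  datumOfTower F N M (towerOfRecord9 h)

/-- It IS `datumOfTower` at the adapter (`rfl`) — every theorem of `T4DatumAssemblyTower` §3 applies by name. [cite: Balaban1987RG1, (0.4) p.253 (bookkeeping)] -/
theorem datumOfTowerOfRecord9_eq (h : TowerProvisos F N ν τ M w ppSel gOf) :
    datumOfTowerOfRecord9 h = datumOfTower F N M (towerOfRecord9 h) := rfl

/-- Its densities ARE `rhoOfRecord9` at the run `(K, F.m, g₀)` (`rfl`) — pointwise statements about `D.dens` ((0.1)∕(2.50) faces) are statements
about def-T's explicit functions. [cite: Balaban1988Convergent, (2.18) p.257 (bookkeeping)] -/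
theorem dens_datumOfTowerOfRecord9 (h : TowerProvisos F N ν τ M w ppSel gOf) (K : ℕ) (g₀ : ℝ) (k : ℕ) :
    (datumOfTowerOfRecord9 h).dens K g₀ k = rhoOfRecord9 F N ν τ M.E w ppSel ⟨K, F.m, g₀⟩ (gOf ⟨K, F.m, g₀⟩) k := rfl

/-- Its realised `𝐓ρ_k` ARE `trhoOfRecord9` (`rfl`). [cite: Balaban1988Convergent, (3.25) p.270 (bookkeeping)] -/
theorem trho_datumOfTowerOfRecord9 (h : TowerProvisos F N ν τ M w ppSel gOf) (K : ℕ) (g₀ : ℝ) (k : ℕ) :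
    (datumOfTowerOfRecord9 h).real.Trho K g₀ k = trhoOfRecord9 F N ν τ M.E w ppSel ⟨K, F.m, g₀⟩ (gOf ⟨K, F.m, g₀⟩) k := rfl

/-- Its construction is the core's over the densities of record (`rfl`) — the term a stage-₉ binding world sets as its `C`.
[cite: Balaban1989LargeFieldII, Thm 1 + (0.1) pp.355–356 (bookkeeping)] -/
theorem datumOfTowerOfRecord9_C (h : TowerProvisos F N ν τ M w ppSel gOf) :
    (datumOfTowerOfRecord9 h).C = M.construction (towerOfRecord9 h).ρ := rfl

/-- Its β-functions are the core's (`rfl`). [cite: Balaban1987RG1, (1.22) p.264 (bookkeeping)] -/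
theorem datumOfTowerOfRecord9_βfun (h : TowerProvisos F N ν τ M w ppSel gOf) : (datumOfTowerOfRecord9 h).βfun = M.βfun := rfl

/-- Its averaging maps are NODE 00's averaging operations of record (`rfl`). [cite: Balaban1987RG1, (0.4) p.253 (bookkeeping)] -/
theorem datumOfTowerOfRecord9_av (h : TowerProvisos F N ν τ M w ppSel gOf) : (datumOfTowerOfRecord9 h).av = avOfRecord F N := rfl

/-- STAGE-0 DATUM CLAUSE (`rfl`). [cite: Balaban1987RG1, (0.3)–(0.4) p.253] -/
theorem isDatumOfRecord₀_datumOfTowerOfRecord9 (h : TowerProvisos F N ν τ M w ppSel gOf) :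
    IsDatumOfRecord₀ F N (datumOfTowerOfRecord9 h) := rfl

/-- **BINDER B1 = NODE N23 AT THE DATUM OF THE TOWER OF RECORD**, hypothesis-free beyond the displayed provisos that BUILD the datum
(`isPrintedAveraged_datumOfTower`). [cite: Balaban1987RG1, (0.4) p.253] -/
theorem isPrintedAveraged_datumOfTowerOfRecord9 (h : TowerProvisos F N ν τ M w ppSel gOf) : (datumOfTowerOfRecord9 h).IsPrintedAveraged :=
  isPrintedAveraged_datumOfTower F N M _

/-- (2.18) holds for the datum's densities with `rep_k` of record, by construction. [cite: Balaban1988Convergent, (2.18) p.257 (bookkeeping)] -/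
theorem holds_dens_datumOfTowerOfRecord9 (h : TowerProvisos F N ν τ M w ppSel gOf) (K : ℕ) (g₀ : ℝ) (k : ℕ) :
    (repOfRecord9 F N ν τ M.E w ppSel ⟨K, F.m, g₀⟩ (gOf ⟨K, F.m, g₀⟩) k).Holds ((datumOfTowerOfRecord9 h).dens K g₀ k) :=
  holds_repOfRecord9 F N ν τ M.E w ppSel _ _ k

/-- Every density of the datum, `k ≤ K`, is integrable (`integrable_towerOfRecord9_ρ` read at the datum). [cite: Balaban1988Convergent, (0.2) p.244 (bookkeeping)] -/
theorem integrable_dens_datumOfTowerOfRecord9 (h : TowerProvisos F N ν τ M w ppSel gOf) (K : ℕ) (g₀ : ℝ) (k : ℕ) (hk : k ≤ K) :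
    Integrable ((datumOfTowerOfRecord9 h).dens K g₀ k) (fieldMeasure (F.P K) k (Matrix.specialUnitaryGroup (Fin N) ℂ)) :=
  integrable_towerOfRecord9_ρ h ⟨K, F.m, g₀⟩ k hk

/-- **THE T⁴ APEX AT THE DATUM OF THE TOWER OF RECORD**, B1 eliminated (`continuumYM4Torus_datumOfTower`). [cite: JaffeWittenClay2006, §6.5 p.11] -/
theorem continuumYM4Torus_datumOfTowerOfRecord9 (h : TowerProvisos F N ν τ M w ppSel gOf)
    (hB : B16.EndStatementBPrinted (datumOfTowerOfRecord9 h).C)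
    (hE : EndpointExistence (datumOfTowerOfRecord9 h).C.toB12)
    (hNE : T4ApexHybrid.HybridNE7Under (datumOfTowerOfRecord9 h) (EndpointExistence (datumOfTowerOfRecord9 h).C.toB12)) :
    T4ContinuumYM4Torus.ContinuumYM4Torus (datumOfTowerOfRecord9 h) :=
  continuumYM4Torus_datumOfTower F N M _ hB hE hNE

/-! ### Along the generated histories: THE SAME `g` feeds `χ_k` and the run's flow -/

/-- The tower of record along the GENERATED histories `genSeq M.βfun p.g0`. [cite: Balaban1987RG1, (0.17)–(0.20) pp.255–256; Balaban1988Convergent, (2.18) p.257] -/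
def towerOfRecord9Gen (h : GenTowerProvisos F N ν τ M w ppSel) : M.Tower (avOfRecord F N) :=
  towerOfRecord9 h.towerProvisos

/-- It IS the adapter at `gOf p := genSeq M.βfun p.g0` (`rfl`). [cite: Balaban1987RG1, (0.17) p.255 (bookkeeping)] -/
theorem towerOfRecord9Gen_eq (h : GenTowerProvisos F N ν τ M w ppSel) : towerOfRecord9Gen h = towerOfRecord9 h.towerProvisos := rfl

/-- **ONE HISTORY**: at the datum of the tower of record along the generated histories, the couplings of the run `p` carried by its flow ARE
`genSeq M.βfun p.g0` — the history its densities' characteristic functions `χ_k(s)` and slots are indexed by (both `rfl`; def-T's plug (5),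
«`Record9` must feed the SAME `g` to `chiSeqOfRecord` and to `(w.C p).flow`»). [cite: Balaban1987RG1, (0.17)–(0.20) pp.255–256; Balaban1988Convergent, (2.17)–(2.18) p.257] -/
theorem flow_g_and_dens_towerOfRecord9Gen (h : GenTowerProvisos F N ν τ M w ppSel) (p : B12.RunParams) :
    ((datumOfTower F N M (towerOfRecord9Gen h)).C p).flow.g = genSeq M.βfun p.g0 ∧
      ∀ k, (datumOfTower F N M (towerOfRecord9Gen h)).dens p.K p.g0 k
        = rhoOfRecord9 F N ν τ M.E w ppSel ⟨p.K, F.m, p.g0⟩ (genSeq M.βfun p.g0) k :=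
  ⟨rfl, fun _ => rfl⟩


/-! ## 4. The tower of record is INTEGRABLE; the shadow obligations discharged at it (the proof fields of `Record9`'s shadow residual) -/

/-- **THE TOWER OF RECORD IS INTEGRABLE** (`RGMachineCore.Tower.IsIntegrable`, READ #43 N-n23-T1's display as a theorem): every `ρ_k`, `k ≤ K`, from
the displayed provisos alone. [cite: Balaban1988Convergent, (0.2) p.244 (kernel property of the tower, bookkeeping)] -/
theorem isIntegrable_towerOfRecord9 (h : TowerProvisos F N ν τ M w ppSel gOf) : (towerOfRecord9 h).IsIntegrable :=
  fun p k hk => integrable_towerOfRecord9_ρ h p k hk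

/-- … along the generated histories. [cite: Balaban1988Convergent, (0.2) p.244 (bookkeeping)] -/
theorem isIntegrable_towerOfRecord9Gen (h : GenTowerProvisos F N ν τ M w ppSel) : (towerOfRecord9Gen h).IsIntegrable :=
  isIntegrable_towerOfRecord9 h.towerProvisos

/-- The SHADOW large-field operation of the tower of record IS `inducedAt (rnTransport (avOfRecord K k) ρ_k) ρ_{k+1}` at def-T's explicit densities
(`rfl`) — the residual `R` a stage-₉ Stage-5-family shadow sets. [cite: Balaban1989LargeFieldI, (0.2)–(0.3) p.176; Balaban1987RG1, (0.13) p.254 (bookkeeping)] -/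
theorem shadowR_towerOfRecord9 (h : TowerProvisos F N ν τ M w ppSel gOf) (p : B12.RunParams) (k : ℕ) :
    (towerOfRecord9 h).shadowR p k
      = inducedAt (AveragingRT.rnTransport (avOfRecord F N p.K k).avg (rhoOfRecord9 F N ν τ M.E w ppSel p (gOf p) k))
          (rhoOfRecord9 F N ν τ M.E w ppSel p (gOf p) (k + 1)) := rfl

/-- **(0.4) FOR THE SHADOW OPERATION OF THE TOWER OF RECORD**, every density, `k < K` — from def-T's two faces at step `k`, the measurability and Haar
bracket of the averaging of record, and the integrability of `ρ_k` from the provisos (the `preservesIntegral_R` proof field of a shadow residual).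
[cite: Balaban1989LargeFieldI, (0.4) p.176] -/
theorem preservesIntegral_shadowR_towerOfRecord9 (h : TowerProvisos F N ν τ M w ppSel gOf) (p : B12.RunParams) (k : ℕ) (hk : k < p.K) :
    PreservesIntegral ((towerOfRecord9 h).shadowR p k) :=
  (towerOfRecord9 h).preservesIntegral_shadowR p k hk (avOfRecord_measurable F N p.K k) (avOfRecord_haarAC F N p.K k hk)
    (integrable_towerOfRecord9_ρ h p k hk.le)

/-- **INTEGRABILITY PRESERVATION for the shadow operation of the tower of record**, `k < K` (the `integrable_R` proof field of a shadow residual).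
[cite: Balaban1989LargeFieldI, (0.3)–(0.4) p.176 (bookkeeping)] -/
theorem integrable_shadowR_towerOfRecord9 (h : TowerProvisos F N ν τ M w ppSel gOf) (p : B12.RunParams) (k : ℕ) (hk : k < p.K)
    (σ : Density (F.P p.K) (k + 1) (Matrix.specialUnitaryGroup (Fin N) ℂ))
    (hσ : Integrable σ (fieldMeasure (F.P p.K) (k + 1) (Matrix.specialUnitaryGroup (Fin N) ℂ))) :
    Integrable ((towerOfRecord9 h).shadowR p k σ) (fieldMeasure (F.P p.K) (k + 1) (Matrix.specialUnitaryGroup (Fin N) ℂ)) :=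
  (towerOfRecord9 h).integrable_shadowR p k (integrable_towerOfRecord9_ρ h p (k + 1) (Nat.succ_le_of_lt hk)) σ hσ

/-- **THE SHADOW MACHINE OF THE TOWER OF RECORD** (`shadowMachineOfRecord` at `isIntegrable_towerOfRecord9`): an `RGMachine` of the Stage-5 family whose
core is `M` (`rfl`) and whose Radon–Nikodym recursion reproduces def-T's densities. [cite: Balaban1988Convergent, (0.2) p.244] -/
def shadowMachineOfTowerOfRecord9 (h : TowerProvisos F N ν τ M w ppSel gOf) : RGMachine F (Matrix.specialUnitaryGroup (Fin N) ℂ) :=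
  shadowMachineOfRecord F N M (towerOfRecord9 h) (isIntegrable_towerOfRecord9 h)

/-- Its core is `M` (`rfl`). [cite: Balaban1988Convergent, (0.2) p.244 (bookkeeping)] -/
theorem shadowMachineOfTowerOfRecord9_toCore (h : TowerProvisos F N ν τ M w ppSel gOf) : (shadowMachineOfTowerOfRecord9 h).toCore = M := rfl

/-- Its large-field operation is the shadow operation of the tower of record (`rfl`). [cite: Balaban1989LargeFieldI, (0.3) p.176 (bookkeeping)] -/
theorem shadowMachineOfTowerOfRecord9_R (h : TowerProvisos F N ν τ M w ppSel gOf) (p : B12.RunParams) (k : ℕ) :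
    (shadowMachineOfTowerOfRecord9 h).R p k = (towerOfRecord9 h).shadowR p k := rfl

/-- **THE STAGE-5-FAMILY SHADOW DATUM has the same construction** as the datum of the tower of record. [cite: Balaban1989LargeFieldII, Thm 1 + (0.1) pp.355–356 (bookkeeping)] -/
theorem datumOfRecord_shadow_C (h : TowerProvisos F N ν τ M w ppSel gOf) :
    (datumOfRecord F N (shadowMachineOfTowerOfRecord9 h)).C = (datumOfTowerOfRecord9 h).C :=
  datumOfRecord_shadowMachineOfRecord_C F N M _ _

/-- … and the same densities — def-T's explicit `rhoOfRecord9`. [cite: Balaban1988Convergent, (2.18) p.257 (bookkeeping)] -/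
theorem dens_datumOfRecord_shadow (h : TowerProvisos F N ν τ M w ppSel gOf) (K : ℕ) (g₀ : ℝ) (k : ℕ) :
    (datumOfRecord F N (shadowMachineOfTowerOfRecord9 h)).dens K g₀ k = rhoOfRecord9 F N ν τ M.E w ppSel ⟨K, F.m, g₀⟩ (gOf ⟨K, F.m, g₀⟩) k :=
  dens_datumOfRecord_shadowMachineOfRecord F N M _ _ K g₀ k

end Adapter

end T4DatumAssembly

end Literature.MathematicalPhysics.QuantumFieldTheory.Balaban1983to89

end
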